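import Literature.MathematicalPhysics.QuantumLattice.HubbardTorusLocalHamiltonianDecomposition
import HarnessLib

/-!
# Translation sums of embedded local observables on the fermionic torus: expectations and
# commutators ("commutators of translation sums of local operators are translation sums of a
# local density")

Topic `Literature/MathematicalPhysics/QuantumLattice`; namespace
`Literature.MathematicalPhysics.QuantumLattice` (the file path). Companion of `InfVolFermionState.lean`
(`torusAvgExpectAt`, `fermionEmbed_toTorusEmb_shiftEmb`), `FermionEmbedLocality.lean` (graded
locality of embedded observables) and `HubbardTorusLocalHamiltonianDecomposition.lean`
(`[H_L, Γ A] = Γ([H_{Λ'}, A])`). Everything is PROVED; two auxiliary definitions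
(`shiftInto`, `commDensity`), no named fact.

Pull a finite region `Λ ⊆ ℤ^d` back into the torus `(ℤ/L)^d` (`x ↦ x mod L`, injective on `Λ`), and
let `Γ = Γ_Λ = fermionEmbed (PolySite.toTorusEmb L _)` be the second quantisation and
`T_v = relabel (Orb.translate v)` the translation automorphisms.

* `expect_sum_relabel_translate_fermionEmbed` — for every local `A ∈ 𝔄_Λ` and torus vector `ψ`:
  `⟨ψ, (Σ_v T_v Γ A) ψ⟩ = L^d · torusAvgExpectAt L Λ A ψ` (the translation SUM of an embedded
  local observable has expectation `L^d ×` the translation-AVERAGED expectation of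
  `InfVolFermionState.lean` §4 — the quantity whose limits define torus-limit states).
* `sum_commutator_relabel_translate_fermionEmbed` — **locality of commutators**: for an EVEN local
  `A ∈ 𝔄_{Λ_A}`, any `C ∈ 𝔄_{Λ_C}`, a finite offset set `Z ∋ c − a` (`a ∈ Λ_A`, `c ∈ Λ_C`) and a
  region `Ω ⊇ Λ_C ∪ ⋃_{z ∈ Z} (Λ_A + z)` fitting into the torus:
  `Σ_v [T_v Γ A, Γ C] = Γ_Ω (commDensity Ω Z A C)`, `commDensity Ω Z A C = Σ_{z∈Z} [τ_z A, C] ∈ 𝔄_Ω`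
  (the translates `T_v Γ A` with `v ∉ Z mod L` are even and supported away from `Γ C`, hence
  commute with it — graded locality, Bratteli–Robinson II §5.2.2; the others are the embedded
  shifted copies `Γ_Ω(τ_z A)`).
* `commutator_sum_relabel_translate` — hence for the translation sums `𝒜 = Σ_v T_v Γ A`,
  `𝒞 = Σ_w T_w Γ C`: `[𝒜, 𝒞] = Σ_w T_w Γ_Ω (commDensity Ω Z A C)` — again a translation sum of an
  embedded LOCAL observable — and `⟨ψ, [𝒜, 𝒞] ψ⟩ = L^d · torusAvgExpectAt L Ω (commDensity Ω Z A C) ψ`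
  (`expect_commutator_sum_relabel_translate`).

This is the finite-volume (periodic) form of the statement that the commutator of two
"summable" translation-invariant derivations of the quasi-local algebra is generated by a local
density (Bratteli–Robinson II §6.2.1, proof of Thm. 6.2.4: `[Σ_X Φ(X), A]` only involves the
`X` meeting the support of `A`). It is what makes sum-rule moments such as `½⟨[𝒥,[H,𝒥]]⟩/L^d`
(`𝒥` a current = translation sum of a bond observable) expectations of LOCAL observables in the
translation-averaged state, hence continuous along torus limits (`InfVolFermionState.IsTorusLimitOf`).

References: O. Bratteli, D. W. Robinson, *Operator Algebras and Quantum Statistical Mechanics 2*,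
2nd ed. (Springer 1997), §5.2.2 (graded commutativity of the CAR algebra), §6.2.1 and proof of
Thm. 6.2.4 [BratteliRobinsonII1997]; S. Friedli, Y. Velenik, *Statistical Mechanics of Lattice
Systems* (CUP 2017), §3.1 (torus, translations) [FriedliVelenik2017].
-/

noncomputable section

namespace Literature.MathematicalPhysics.QuantumLattice

open Matrix Finset HubbardWave0 Literature.Probability.LatticeModels
open scoped ComplexOrder

variable {d : ℕ}

/-! ### Boxes fit into large tori -/

/-- `x ↦ x mod L` is injective on the centred box `[-M, M]^d` as soon as `2M < L`.
[cite: FriedliVelenik2017, §3.1] -/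
theorem injOn_proj_box {M L : ℕ} (hML : 2 * M < L) :
    Set.InjOn (Torus.proj (d := d) L) ↑(box d M) := by
  intro x hx y hy hxy
  refine Torus.proj_injective_of_abs_sub_lt (fun j => ?_) hxy
  rw [Finset.mem_coe, mem_box] at hx hy
  have h1 := hx j
  have h2 := hy j
  have hML' : (2 * M : ℤ) < L := by exact_mod_cast hML
  rw [abs_lt]
  constructor <;> linarith [h1.1, h1.2, h2.1, h2.2]

/-- Differences of box points: `c - a ∈ [-(M+N), M+N]^d` for `a ∈ [-M,M]^d`, `c ∈ [-N,N]^d`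
(the boxes `B(n)` of the cited text). [cite: FriedliVelenik2017, §3.2] -/
theorem sub_mem_box_add {M N : ℕ} {a c : Site d} (ha : a ∈ box d M) (hc : c ∈ box d N) :
    c - a ∈ box d (M + N) := by
  rw [mem_box] at ha hc ⊢
  intro i
  have h1 := ha i
  have h2 := hc i
  simp only [Pi.sub_apply, Nat.cast_add]
  constructor <;> linarith [h1.1, h1.2, h2.1, h2.2]

/-- Translates of box points: `Λ + z ⊆ [-(M+N), M+N]^d` for `Λ ⊆ [-M,M]^d`, `z ∈ [-N,N]^d`
(the boxes `B(n)` of the cited text). [cite: FriedliVelenik2017, §3.2] -/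
theorem shiftSet_subset_box_add {M N : ℕ} {Λ : Finset (Site d)} (hΛ : Λ ⊆ box d M) {z : Site d}
    (hz : z ∈ box d N) : shiftSet z Λ ⊆ box d (M + N) := by
  intro x hx
  rw [mem_shiftSet] at hx
  have h1 := mem_box.1 (hΛ hx)
  have h2 := mem_box.1 hz
  rw [mem_box]
  intro i
  have h1i := h1 i
  have h2i := h2 i
  simp only [Pi.sub_apply, Nat.cast_add] at h1i ⊢
  constructor <;> linarith [h1i.1, h1i.2, h2i.1, h2i.2]

/-! ### Translation sums of embedded local observables: expectations -/

section TranslationSums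

variable (L : ℕ) [NeZero L]

/-- `|(ℤ/L)^d| = L^d`. [folklore] -/
private theorem card_torusSite_eq_pow : Fintype.card (TorusSite d L) = L ^ d := by
  simp [ZMod.card, Fintype.card_fin]

/-- The expectation of a finite sum of operators is the sum of the expectations. [folklore] -/
private theorem expect_finset_sum {ι κ : Type*} [LinearOrder ι] [Fintype ι] (s : Finset κ)
    (f : κ → Matrix (Finset ι) (Finset ι) ℂ) (ψ : Fock ι) :
    expect (∑ k ∈ s, f k) ψ = ∑ k ∈ s, expect (f k) ψ := by
  rw [expect, Matrix.sum_mulVec, dotProduct_sum]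
  rfl

/-- **Expectation of a translation sum.** For a region `Λ` fitting into the torus, a local
observable `A ∈ 𝔄_Λ` and a torus vector `ψ`:
`⟨ψ, (Σ_v T_v Γ A) ψ⟩ = |𝕋| · torusAvgExpectAt L Λ A ψ` (reindex `v ↦ -v` in the average
`Σ_v ⟨U_v ψ, Γ A U_v ψ⟩ = Σ_v ⟨ψ, T_{-v}(Γ A) ψ⟩`). [cite: BratteliRobinsonI1987, §4.3.1] -/
theorem expect_sum_relabel_translate_fermionEmbed {Λ : Finset (Site d)}
    (hΛ : Set.InjOn (Torus.proj (d := d) L) ↑Λ) (A : FermionOp Λ) (ψ : Fock (Orb (FermionTorus d L))) :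
    expect (∑ v : TorusSite d L, relabel (Orb.translate v) (fermionEmbed (PolySite.toTorusEmb L hΛ) A)) ψ =
      (Fintype.card (TorusSite d L) : ℂ) * torusAvgExpectAt L Λ A ψ := by
  rw [torusAvgExpectAt_of_injOn L hΛ, ← mul_assoc,
    mul_inv_cancel₀ (Nat.cast_ne_zero.2 Fintype.card_ne_zero), one_mul, expect_finset_sum]
  have hstep : ∀ v : TorusSite d L,
      expect (fermionEmbed (PolySite.toTorusEmb L hΛ) A) ((fockTranslate v).val *ᵥ ψ) =
        expect (relabel (Orb.translate (-v)) (fermionEmbed (PolySite.toTorusEmb L hΛ) A)) ψ := by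
    intro v
    rw [expect_fockRelabel_mulVec, ← Equiv.Perm.inv_def, ← Orb.translate_neg]
  simp_rw [hstep]
  exact (Fintype.sum_equiv (Equiv.neg (TorusSite d L))
    (fun v => expect (relabel (Orb.translate (-v)) (fermionEmbed (PolySite.toTorusEmb L hΛ) A)) ψ)
    (fun v => expect (relabel (Orb.translate v) (fermionEmbed (PolySite.toTorusEmb L hΛ) A)) ψ)
    (fun v => rfl)).symm

/-- The same with `|𝕋| = L^d`. [cite: BratteliRobinsonI1987, §4.3.1] -/
theorem expect_sum_relabel_translate_fermionEmbed' {Λ : Finset (Site d)}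
    (hΛ : Set.InjOn (Torus.proj (d := d) L) ↑Λ) (A : FermionOp Λ) (ψ : Fock (Orb (FermionTorus d L))) :
    expect (∑ v : TorusSite d L, relabel (Orb.translate v) (fermionEmbed (PolySite.toTorusEmb L hΛ) A)) ψ =
      ((L : ℂ) ^ d) * torusAvgExpectAt L Λ A ψ := by
  rw [expect_sum_relabel_translate_fermionEmbed L hΛ A ψ, card_torusSite_eq_pow, Nat.cast_pow]

/-! ### Translates of embedded observables through a bigger region -/

/-- **A translate of an embedded observable is an embedded shifted observable**: for `Λ + z ⊆ Ω`
(`Ω` fitting into the torus), `T_{z mod L} (Γ_Λ A) = Γ_Ω (Γ(incl) (Γ(τ_z) A))`.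
[cite: ArakiMoriya2003, §4.1 Def. 4.3] -/
theorem relabel_translate_proj_fermionEmbed {Λ Ω : Finset (Site d)}
    (hΩ : Set.InjOn (Torus.proj (d := d) L) ↑Ω) (hΛ : Set.InjOn (Torus.proj (d := d) L) ↑Λ)
    (z : Site d) (hz : shiftSet z Λ ⊆ Ω) (A : FermionOp Λ) :
    relabel (Orb.translate (Torus.proj L z)) (fermionEmbed (PolySite.toTorusEmb L hΛ) A) =
      fermionEmbed (PolySite.toTorusEmb L hΩ)
        (fermionEmbed (PolySite.incl hz) (fermionEmbed (PolySite.shiftEmb z Λ) A)) := by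
  have h' : Set.InjOn (Torus.proj (d := d) L) ↑(shiftSet z Λ) := hΩ.mono (Finset.coe_subset.2 hz)
  rw [← fermionEmbed_toTorusEmb_shiftEmb L z hΛ h' A, fermionEmbed_fermionEmbed (PolySite.incl hz)]
  congr 1

/-- **The commutator of the Hubbard torus Hamiltonian with a translation sum** of an embedded local
observable is the translation sum of the embedded LOCAL commutator: for `A ∈ 𝔄_Λ`, `Λ' ⊇ Λ`
containing all lattice neighbours of `Λ`, and `x ↦ x mod L` injective on `thicken Λ' 1`,
`H_L (Σ_v T_v Γ A) − (Σ_v T_v Γ A) H_L = Σ_v T_v Γ_{Λ'}(H_{Λ'} A − A H_{Λ'})`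
(translation invariance of `H_L` and `hubbardTorus_commutator_fermionEmbed` term by term).
[cite: BratteliRobinsonII1997, Thm. 6.2.4] -/
theorem hubbardTorus_commutator_sum_relabel_translate (t U : ℝ) {Λ Λ' : Finset (Site d)}
    (hΛ : Λ ⊆ Λ') (hclosed : ∀ x ∈ Λ, ∀ i : Fin d, x + unitVec i ∈ Λ' ∧ x - unitVec i ∈ Λ')
    (hInj : Set.InjOn (Torus.proj (d := d) L) ↑(thicken Λ' 1)) (A : FermionOp Λ) :
    hubbardTorus d L t U *
          (∑ v : TorusSite d L, relabel (Orb.translate v)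
            (fermionEmbed (PolySite.toTorusEmb L (hInj.mono (by exact_mod_cast subset_thicken Λ' 1)))
              (fermionEmbed (PolySite.incl hΛ) A))) -
        (∑ v : TorusSite d L, relabel (Orb.translate v)
            (fermionEmbed (PolySite.toTorusEmb L (hInj.mono (by exact_mod_cast subset_thicken Λ' 1)))
              (fermionEmbed (PolySite.incl hΛ) A))) * hubbardTorus d L t U =
      ∑ v : TorusSite d L, relabel (Orb.translate v)
        (fermionEmbed (PolySite.toTorusEmb L (hInj.mono (by exact_mod_cast subset_thicken Λ' 1)))
          ((hubbardFermionInteraction d t U).localHamiltonian Λ' * fermionEmbed (PolySite.incl hΛ) A -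
            fermionEmbed (PolySite.incl hΛ) A * (hubbardFermionInteraction d t U).localHamiltonian Λ')) := by
  rw [Finset.mul_sum, Finset.sum_mul, ← Finset.sum_sub_distrib]
  refine Finset.sum_congr rfl fun v _ => ?_
  rw [← hubbardTorus_commutator_fermionEmbed L t U hΛ hclosed hInj A, relabel_sub, relabel_mul, relabel_mul,
    relabel_translate_hubbardTorus]

/-! ### Commutators of translation sums with embedded local observables -/

/-- The copy of `A ∈ 𝔄_Λ` shifted by `z`, as an observable of `Ω ⊇ Λ + z` (junk value `0` if
`Λ + z ⊄ Ω`). [cite: ArakiMoriya2003, §4.1 Def. 4.3] -/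
def shiftInto (Ω : Finset (Site d)) {Λ : Finset (Site d)} (z : Site d) (A : FermionOp Λ) : FermionOp Ω :=
  if h : shiftSet z Λ ⊆ Ω then fermionEmbed (PolySite.incl h) (fermionEmbed (PolySite.shiftEmb z Λ) A)
  else 0

/-- `shiftInto` when the shifted region fits (`τ_k(𝔄(I)) = 𝔄(I + k)`). [cite: ArakiMoriya2003, §4.1 Def. 4.3] -/
theorem shiftInto_of_subset (Ω : Finset (Site d)) {Λ : Finset (Site d)} {z : Site d}
    (h : shiftSet z Λ ⊆ Ω) (A : FermionOp Λ) :
    shiftInto Ω z A = fermionEmbed (PolySite.incl h) (fermionEmbed (PolySite.shiftEmb z Λ) A) := by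
  rw [shiftInto, dif_pos h]

/-- **The local commutator density** of `A ∈ 𝔄_{Λ_A}` against `C ∈ 𝔄_{Λ_C}` over the offset set
`Z`, inside `Ω`: `Σ_{z ∈ Z} (τ_z A · C − C · τ_z A) ∈ 𝔄_Ω`. [cite: BratteliRobinsonII1997, §6.2.1] -/
def commDensity (Ω Z : Finset (Site d)) {ΛA ΛC : Finset (Site d)} (hC : ΛC ⊆ Ω)
    (A : FermionOp ΛA) (C : FermionOp ΛC) : FermionOp Ω :=
  ∑ z ∈ Z, (shiftInto Ω z A * fermionEmbed (PolySite.incl hC) C -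
    fermionEmbed (PolySite.incl hC) C * shiftInto Ω z A)

/-- `Torus.proj` respects subtraction. [folklore] -/
private theorem proj_sub' (L : ℕ) (x y : Site d) :
    Torus.proj L (x - y) = Torus.proj L x - Torus.proj L y := by
  funext i
  simp [Torus.proj]

/-- **Far translates commute**: if `v ∈ (ℤ/L)^d` is NOT of the form `(c - a) mod L` with
`a ∈ Λ_A`, `c ∈ Λ_C` — guaranteed by `v ∉ Z mod L` when `Z ∋ c − a` for all such pairs — then
the translate `T_v Γ A` of an EVEN local `A` commutes with `Γ C` (their orbital supports are
disjoint; graded commutativity). [cite: BratteliRobinsonII1997, §5.2.2] -/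
theorem commute_relabel_translate_fermionEmbed_of_not_mem {ΛA ΛC Z : Finset (Site d)}
    (hΛA : Set.InjOn (Torus.proj (d := d) L) ↑ΛA) (hΛC : Set.InjOn (Torus.proj (d := d) L) ↑ΛC)
    (hcomplete : ∀ a ∈ ΛA, ∀ c ∈ ΛC, c - a ∈ Z)
    {A : FermionOp ΛA} (hAeven : A ∈ carEvenSubalgebra (Finset.univ : Finset (Orb (PolySite ΛA))))
    (C : FermionOp ΛC) {v : TorusSite d L} (hv : v ∉ Z.image (Torus.proj L)) :
    Commute (relabel (Orb.translate v) (fermionEmbed (PolySite.toTorusEmb L hΛA) A))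
      (fermionEmbed (PolySite.toTorusEmb L hΛC) C) := by
  classical
  -- write `v = z mod L`
  obtain ⟨z, rfl⟩ : ∃ z : Site d, Torus.proj L z = v := ⟨Torus.cRep v, Torus.proj_cRep v⟩
  have h' : Set.InjOn (Torus.proj (d := d) L) ↑(shiftSet z ΛA) := (injOn_proj_shiftSet_iff L z ΛA).2 hΛA
  rw [← fermionEmbed_toTorusEmb_shiftEmb L z hΛA h' A]
  -- evenness and support of the translate
  have hmem : fermionEmbed (PolySite.toTorusEmb L h') (fermionEmbed (PolySite.shiftEmb z ΛA) A) ∈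
      carEvenSubalgebra (orbs ((Finset.univ : Finset (PolySite (shiftSet z ΛA))).map
        (PolySite.toTorusEmb L h'))) :=
    fermionEmbed_mem_carEvenSubalgebra _
      (carEvenSubalgebra_mono (Finset.subset_univ _) (fermionEmbed_mem_carEvenSubalgebra _ hAeven))
  refine commute_of_mem_carEvenSubalgebra hmem (fermionEmbed_mem_carSubalgebra _ C) ?_
  refine disjoint_orbs (Finset.disjoint_left.2 fun x hx hx' => hv ?_)
  obtain ⟨p, -, rfl⟩ := Finset.mem_map.1 hx
  obtain ⟨q, -, hq⟩ := Finset.mem_map.1 hx'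
  have hp : ofLex p.1 - z ∈ ΛA := mem_shiftSet.1 (PolySite.ofLex_mem p)
  have hq' : ofLex q.1 ∈ ΛC := PolySite.ofLex_mem q
  refine Finset.mem_image.2 ⟨_, hcomplete _ hp _ hq', ?_⟩
  have hpq : Torus.proj L (ofLex q.1) = Torus.proj L (ofLex p.1) := by
    have := congrArg FermionTorus.toTorusSite hq
    rwa [PolySite.toTorusEmb_apply, PolySite.toTorusEmb_apply, FermionTorus.toTorusSite_ofTorusSite,
      FermionTorus.toTorusSite_ofTorusSite] at this
  rw [proj_sub', proj_sub', hpq, sub_sub_cancel]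

/-- **Locality of commutators on the torus.** Let `A ∈ 𝔄_{Λ_A}` be EVEN, `C ∈ 𝔄_{Λ_C}`, `Z` a finite
set of offsets containing every `c − a` (`a ∈ Λ_A`, `c ∈ Λ_C`) and fitting into the torus, and
`Ω ⊇ Λ_A, Λ_C, Λ_A + z (z ∈ Z)` a region fitting into the torus. Then
`Σ_{v ∈ (ℤ/L)^d} (T_v Γ A · Γ C − Γ C · T_v Γ A) = Γ_Ω (commDensity Ω Z A C)`:
only the translates by `z mod L`, `z ∈ Z`, contribute, and they are the embedded shifted copies.
[cite: BratteliRobinsonII1997, §6.2.1 and proof of Thm. 6.2.4] -/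
theorem sum_commutator_relabel_translate_fermionEmbed {ΛA ΛC Ω Z : Finset (Site d)}
    (hΩ : Set.InjOn (Torus.proj (d := d) L) ↑Ω) (hZinj : Set.InjOn (Torus.proj (d := d) L) ↑Z)
    (hA : ΛA ⊆ Ω) (hC : ΛC ⊆ Ω) (hZ : ∀ z ∈ Z, shiftSet z ΛA ⊆ Ω)
    (hcomplete : ∀ a ∈ ΛA, ∀ c ∈ ΛC, c - a ∈ Z)
    {A : FermionOp ΛA} (hAeven : A ∈ carEvenSubalgebra (Finset.univ : Finset (Orb (PolySite ΛA))))
    (C : FermionOp ΛC) :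
    ∑ v : TorusSite d L,
        (relabel (Orb.translate v) (fermionEmbed (PolySite.toTorusEmb L (hΩ.mono (Finset.coe_subset.2 hA))) A) *
            fermionEmbed (PolySite.toTorusEmb L (hΩ.mono (Finset.coe_subset.2 hC))) C -
          fermionEmbed (PolySite.toTorusEmb L (hΩ.mono (Finset.coe_subset.2 hC))) C *
            relabel (Orb.translate v)
              (fermionEmbed (PolySite.toTorusEmb L (hΩ.mono (Finset.coe_subset.2 hA))) A)) =
      fermionEmbed (PolySite.toTorusEmb L hΩ) (commDensity Ω Z hC A C) := by
  classical
  set ΓA := fermionEmbed (PolySite.toTorusEmb L (hΩ.mono (Finset.coe_subset.2 hA))) A with hΓA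
  set ΓC := fermionEmbed (PolySite.toTorusEmb L (hΩ.mono (Finset.coe_subset.2 hC))) C with hΓC
  -- (1) the far translates do not contribute
  have hfar : ∀ v ∈ (Finset.univ : Finset (TorusSite d L)), v ∉ Z.image (Torus.proj L) →
      relabel (Orb.translate v) ΓA * ΓC - ΓC * relabel (Orb.translate v) ΓA = 0 := by
    intro v _ hv
    rw [(commute_relabel_translate_fermionEmbed_of_not_mem L _ _ hcomplete hAeven C hv).eq, sub_self]
  rw [← Finset.sum_subset (Finset.subset_univ (Z.image (Torus.proj L))) hfar,
    Finset.sum_image hZinj]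
  -- (2) the near translates are the embedded shifted copies
  rw [commDensity, fermionEmbed_sum]
  refine Finset.sum_congr rfl fun z hz => ?_
  rw [fermionEmbed_sub, fermionEmbed_mul, fermionEmbed_mul, shiftInto_of_subset Ω (hZ z hz),
    ← relabel_translate_proj_fermionEmbed L hΩ (hΩ.mono (Finset.coe_subset.2 hA)) z (hZ z hz) A,
    hΓC, fermionEmbed_fermionEmbed (PolySite.incl hC)]
  congr 1

/-- `T_w (T_u X) = T_{u + w} X`. [folklore] -/
private theorem relabel_translate_relabel_translate (u w : TorusSite d L)
    (X : Matrix (Finset (Orb (FermionTorus d L))) (Finset (Orb (FermionTorus d L))) ℂ) :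
    relabel (Orb.translate w) (relabel (Orb.translate u) X) = relabel (Orb.translate (u + w)) X := by
  rw [add_comm, Orb.translate_add, Equiv.Perm.mul_def, relabel_trans]

/-- **Abstract form**: if the single translation sum of commutators `Σ_v [T_v X, Y]` equals `D`, then
the commutator of the two translation sums `Σ_v T_v X`, `Σ_w T_w Y` is the translation sum
`Σ_w T_w D` (translate the single-sum identity by `w` and reindex `v ↦ v + w`).
[cite: BratteliRobinsonII1997, §6.2.1] -/
theorem commutator_sum_relabel_translate_of_eq
    {X Y D : Matrix (Finset (Orb (FermionTorus d L))) (Finset (Orb (FermionTorus d L))) ℂ}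
    (hloc : ∑ v : TorusSite d L,
      (relabel (Orb.translate v) X * Y - Y * relabel (Orb.translate v) X) = D) :
    (∑ v : TorusSite d L, relabel (Orb.translate v) X) * (∑ w : TorusSite d L, relabel (Orb.translate w) Y) -
        (∑ w : TorusSite d L, relabel (Orb.translate w) Y) * (∑ v : TorusSite d L, relabel (Orb.translate v) X) =
      ∑ w : TorusSite d L, relabel (Orb.translate w) D := by
  have hrhs : ∀ w : TorusSite d L, relabel (Orb.translate w) D =
      ∑ v : TorusSite d L, (relabel (Orb.translate v) X * relabel (Orb.translate w) Y -
        relabel (Orb.translate w) Y * relabel (Orb.translate v) X) := by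
    intro w
    rw [← hloc, relabel_sum]
    simp only [relabel_sub, relabel_mul, relabel_translate_relabel_translate]
    exact Fintype.sum_equiv (Equiv.addRight w)
      (fun u => relabel (Orb.translate (u + w)) X * relabel (Orb.translate w) Y -
        relabel (Orb.translate w) Y * relabel (Orb.translate (u + w)) X)
      (fun v => relabel (Orb.translate v) X * relabel (Orb.translate w) Y -
        relabel (Orb.translate w) Y * relabel (Orb.translate v) X) (fun u => rfl)
  simp_rw [hrhs]
  rw [Finset.sum_mul_sum, Finset.sum_mul_sum, Finset.sum_comm, ← Finset.sum_sub_distrib]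
  refine Finset.sum_congr rfl fun w _ => ?_
  rw [← Finset.sum_sub_distrib]

/-- **The commutator of two translation sums is a translation sum of the local commutator density.**
With `𝒜 = Σ_v T_v Γ A`, `𝒞 = Σ_w T_w Γ C` (hypotheses of
`sum_commutator_relabel_translate_fermionEmbed`):
`𝒜 𝒞 − 𝒞 𝒜 = Σ_w T_w (Γ_Ω (commDensity Ω Z A C))`.
[cite: BratteliRobinsonII1997, §6.2.1 and proof of Thm. 6.2.4] -/
theorem commutator_sum_relabel_translate {ΛA ΛC Ω Z : Finset (Site d)}
    (hΩ : Set.InjOn (Torus.proj (d := d) L) ↑Ω) (hZinj : Set.InjOn (Torus.proj (d := d) L) ↑Z)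
    (hA : ΛA ⊆ Ω) (hC : ΛC ⊆ Ω) (hZ : ∀ z ∈ Z, shiftSet z ΛA ⊆ Ω)
    (hcomplete : ∀ a ∈ ΛA, ∀ c ∈ ΛC, c - a ∈ Z)
    {A : FermionOp ΛA} (hAeven : A ∈ carEvenSubalgebra (Finset.univ : Finset (Orb (PolySite ΛA))))
    (C : FermionOp ΛC) :
    (∑ v : TorusSite d L, relabel (Orb.translate v)
        (fermionEmbed (PolySite.toTorusEmb L (hΩ.mono (Finset.coe_subset.2 hA))) A)) *
        (∑ w : TorusSite d L, relabel (Orb.translate w)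
          (fermionEmbed (PolySite.toTorusEmb L (hΩ.mono (Finset.coe_subset.2 hC))) C)) -
      (∑ w : TorusSite d L, relabel (Orb.translate w)
        (fermionEmbed (PolySite.toTorusEmb L (hΩ.mono (Finset.coe_subset.2 hC))) C)) *
        (∑ v : TorusSite d L, relabel (Orb.translate v)
          (fermionEmbed (PolySite.toTorusEmb L (hΩ.mono (Finset.coe_subset.2 hA))) A)) =
      ∑ w : TorusSite d L, relabel (Orb.translate w)
        (fermionEmbed (PolySite.toTorusEmb L hΩ) (commDensity Ω Z hC A C)) :=
  commutator_sum_relabel_translate_of_eq L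
    (sum_commutator_relabel_translate_fermionEmbed L hΩ hZinj hA hC hZ hcomplete hAeven C)

/-- **Expectation form**: `⟨ψ, [𝒜, 𝒞] ψ⟩ = L^d · torusAvgExpectAt L Ω (commDensity Ω Z A C) ψ` — the
commutator of two translation sums has, per site, the translation-averaged expectation of a LOCAL
observable. [cite: BratteliRobinsonII1997, §6.2.1] -/
theorem expect_commutator_sum_relabel_translate {ΛA ΛC Ω Z : Finset (Site d)}
    (hΩ : Set.InjOn (Torus.proj (d := d) L) ↑Ω) (hZinj : Set.InjOn (Torus.proj (d := d) L) ↑Z)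
    (hA : ΛA ⊆ Ω) (hC : ΛC ⊆ Ω) (hZ : ∀ z ∈ Z, shiftSet z ΛA ⊆ Ω)
    (hcomplete : ∀ a ∈ ΛA, ∀ c ∈ ΛC, c - a ∈ Z)
    {A : FermionOp ΛA} (hAeven : A ∈ carEvenSubalgebra (Finset.univ : Finset (Orb (PolySite ΛA))))
    (C : FermionOp ΛC) (ψ : Fock (Orb (FermionTorus d L))) :
    expect ((∑ v : TorusSite d L, relabel (Orb.translate v)
        (fermionEmbed (PolySite.toTorusEmb L (hΩ.mono (Finset.coe_subset.2 hA))) A)) *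
        (∑ w : TorusSite d L, relabel (Orb.translate w)
          (fermionEmbed (PolySite.toTorusEmb L (hΩ.mono (Finset.coe_subset.2 hC))) C)) -
      (∑ w : TorusSite d L, relabel (Orb.translate w)
        (fermionEmbed (PolySite.toTorusEmb L (hΩ.mono (Finset.coe_subset.2 hC))) C)) *
        (∑ v : TorusSite d L, relabel (Orb.translate v)
          (fermionEmbed (PolySite.toTorusEmb L (hΩ.mono (Finset.coe_subset.2 hA))) A))) ψ =
      ((L : ℂ) ^ d) * torusAvgExpectAt L Ω (commDensity Ω Z hC A C) ψ := by
  rw [commutator_sum_relabel_translate L hΩ hZinj hA hC hZ hcomplete hAeven C,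
    expect_sum_relabel_translate_fermionEmbed' L hΩ]

end TranslationSums

end Literature.MathematicalPhysics.QuantumLattice

end
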